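import Literature.NumberTheory.Rogawski1990.CMThetaDockingClauses   -- ★ `CMThetaDockingClauses` and its vocabulary (`CMLocalAPacket.CharIdentityAt`, `ThetaTypeAtCM`, `KeysCaseTwoLabels`, …)
import HarnessLib

/-!
# `πˢ(ξ_v)` — the supercuspidal completion of Rogawski's character identity — IS the `U(1)`-theta type (statement only)

Gelbart–Rogawski, *L-functions and Fourier–Jacobi coefficients for the unitary group U(3)*, Invent. Math. 105 (1991), Lem. 5.1.2 with Thm. 5.1.1
(p. 466); Rogawski, *The multiplicity formula for A-packets* (1992), Thm. 1.1; Rogawski, Ann. of Math. Stud. 123 (1990), Prop. 13.1.3 (d) p. 199.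
At a finite place `v` of `L⁺` that does not split in the CM field `L`, the local A-packet `Π(ξ_v) = {πⁿ(ξ_v), πˢ(ξ_v)}` of a one-dimensional `ξ` of the
endoscopic `H = U(2) × U(1)` has a UNIQUE supercuspidal member `πˢ(ξ_v)` pinned by the character identity (13.1.4) `χ_ξ(f^H) = tr πⁿ(f) + tr πˢ(f)`; the print
theorem typed here says that this `πˢ(ξ_v)` is the supercuspidal Weil (theta) representation `ω(γ_v, ψ′_v, χ_v)` of the OTHER class of lines — in the tree's
currency, a theta type `X_v(μ, ε, χ_f) ∘ κ_v⁻¹` (★ `ThetaTypeAtCM`) for the pair `(μ, χ_f)` on the two dictionary equations of ★ `CMThetaDockingClauses`.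
The printed proof is GLOBAL (theta correspondence + the trace formula: GR91 §5, Rogawski 1992); there is no in-house road tonight.  STATEMENT ONLY:
`piSCompletion_isThetaTypeAtCM` is a `Prop`-valued definition on the SAME binders as ★ `CMThetaDockingClauses` (global transfer data `(Δ, m_H, m_G)`, Haar
families `ν_H, ν_G`, `ξ`, `μω`, local characters `ξloc`, theta frame `(e₁, dV, g)`), whose body is, TOKEN FOR TOKEN, the «theta WITNESS» hypothesis `hW` of ★
`F0P2oCharIdentityCompletionUnique.cmThetaDockingClauses_of_thetaWitness` (crux H413, programme P2, (D-a)): for every binder tuple of the docking clause SOME class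
`πθ` completing `πⁿ ∘ e` in (13.1.4) is a theta type.  With G-surjective matching (★ `IsLocalDeltaTransferExists`) that junction turns it into ★
`CMThetaDockingClauses` (uniqueness of the completion, Prop. 13.1.3 (d), is PROVED there).  No instance, no notation, no `sorry`; nothing is asserted.

* `piSCompletion_isThetaTypeAtCM` — the named fact (D-b) of the P2 line tree (`Cruxes/H413/Lines/F0_P2PKPiRung4.lean`, ENGINE stub `stub_D7αMemDock`).
* `piSCompletion_isThetaTypeAtCM_iff` — its unfolding (`Iff.rfl`), so that `hW := (piSCompletion_isThetaTypeAtCM_iff …).1 h` or simply `h`.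

## References
* [GelbartRogawski1991] S. Gelbart, J. Rogawski, Invent. Math. 105 (1991): Lem. 5.1.2, Thm. 5.1.1 p. 465; Remark p. 466–467.
* [Rogawski1992] J. Rogawski, *The multiplicity formula for A-packets*, in: The zeta functions of Picard modular surfaces, CRM Montréal (1992) 395–419: Thm. 1.1 p. 396.
* [Rogawski1990] J. Rogawski, Ann. of Math. Stud. 123 (1990): §13.1 Prop. 13.1.3 (d), Prop. 13.1.4 p. 199.
-/

noncomputable section

open NumberField IsDedekindDomain MeasureTheory
open scoped Matrix ComplexOrder

namespace Literature.NumberTheory.GelbartRogawski1991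

open Literature.NumberTheory Literature.NumberTheory.Automorphic Literature.NumberTheory.Automorphic.UnitaryGroup
open Literature.NumberTheory.Automorphic.IdeleClassGroup
open Literature.NumberTheory.Automorphic.Liu2021 Literature.NumberTheory.Automorphic.Liu2021.Def411WeilCarriers
open Literature.NumberTheory.GaloisRepresentations
open Literature.NumberTheory.Rogawski1990

variable (L : Type) [Field L] [NumberField L] [IsCMField L] (H : Matrix (Fin 3) (Fin 3) L)

/-- **(D-b) `πˢ(ξ_v)` IS THE THETA TYPE OF THE OTHER LINE CLASS** [GelbartRogawski1991 Lem. 5.1.2 + Thm. 5.1.1; Rogawski1992 Thm. 1.1; Rogawski1990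
Prop. 13.1.3 (d)], on GIVEN global transfer data (the binders of ★ `CMThetaDockingClauses`, same order): for every pair `(μ, χ_f)` on the two dictionary equations,
every finite `v` of `L⁺` non-split in `L`, every form congruence `ᵗT̄·H_v·T = a·Φ₃`, every Haar measure `μZ` on `U(Φ₃)(L⁺_v) ⧸ Z` and every Keys-labelled pair
`(π², πⁿ)` with `πⁿ` not square-integrable, THERE IS a line class `ε` and a class `πθ` of `U(H)(L⁺_v)` such that the packet `⟨πⁿ ∘ e, some πθ⟩` satisfies the
character identity (13.1.4) for this data AND `πθ` is the theta type `X_v(μ, ε, χ_f) ∘ κ_v⁻¹` — «the trace-pinned `πˢ(ξ_v)` of the (13.1.4)-completion is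
the `U(1)`-theta type».  PRINT, GLOBAL proof (theta correspondence + trace formula); no in-house road; consumed BY NAME as the hypothesis `hW` of ★
`F0P2oCharIdentityCompletionUnique.cmThetaDockingClauses_of_thetaWitness` (its body is this body, token for token).  A predicate on the data, print-true for
Rogawski's canonical transfer data — to be asserted only where ★ `CMThetaDockingClauses` is (inside the joint existential of the transfer package), never free-standing.
PRINT-TRUE ONLY AT ADMISSIBLE ∕ CANONICAL TRANSFER DATA: consumers must BIND `(Δ, mH, mG, νH, νG, ξloc)` to the matching package of record (Langlands–Shelstad
`Δ_v`, admissible orbital measures, Haar `ν_H, ν_G`, the endoscopic characters of record) — never ∀-close this predicate over them (at the junk datum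
`(Δ, mH, mG, νH) = 0` every pair matches and the identity (13.1.4) is refutable; F0P2-ref1 (g5) r235).
[cite: GelbartRogawski1991, Lem. 5.1.2 p. 466; Thm. 5.1.1 p. 465] [cite: Rogawski1992, Thm. 1.1 p. 396] [cite: Rogawski1990, §13.1 Prop. 13.1.3 (d), Prop. 13.1.4 p. 199] -/
def piSCompletion_isThetaTypeAtCM
    [∀ v : HeightOneSpectrum (𝓞 ↥(maximalRealSubfield L)), MeasurableSpace ((cmDatum L 3 H).Local v)]
    [∀ v : HeightOneSpectrum (𝓞 ↥(maximalRealSubfield L)),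
      MeasurableSpace ((cmDatum L 2 (Matrix.of fun i j : Fin 2 => if i.val + j.val + 1 = 2 then (1 : L) else 0)).Local v ×
        (cmDatum L 1 (Matrix.of fun i j : Fin 1 => if i.val + j.val + 1 = 1 then (1 : L) else 0)).Local v)]
    [∀ (v : HeightOneSpectrum (𝓞 ↥(maximalRealSubfield L)))
        (a : ((cmDatum L 2 (Matrix.of fun i j : Fin 2 => if i.val + j.val + 1 = 2 then (1 : L) else 0)).Local v ×
          (cmDatum L 1 (Matrix.of fun i j : Fin 1 => if i.val + j.val + 1 = 1 then (1 : L) else 0)).Local v)),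
      MeasurableSpace (((cmDatum L 2 (Matrix.of fun i j : Fin 2 => if i.val + j.val + 1 = 2 then (1 : L) else 0)).Local v ×
          (cmDatum L 1 (Matrix.of fun i j : Fin 1 => if i.val + j.val + 1 = 1 then (1 : L) else 0)).Local v) ⧸
        Subgroup.centralizer ({a} : Set ((cmDatum L 2 (Matrix.of fun i j : Fin 2 => if i.val + j.val + 1 = 2 then (1 : L) else 0)).Local v ×
          (cmDatum L 1 (Matrix.of fun i j : Fin 1 => if i.val + j.val + 1 = 1 then (1 : L) else 0)).Local v)))]
    [∀ (v : HeightOneSpectrum (𝓞 ↥(maximalRealSubfield L))) (γ : (cmDatum L 3 H).Local v),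
      MeasurableSpace ((cmDatum L 3 H).Local v ⧸ Subgroup.centralizer ({γ} : Set ((cmDatum L 3 H).Local v)))]
    (Δ : ∀ v : HeightOneSpectrum (𝓞 ↥(maximalRealSubfield L)), LocalTransferFactor L H v)
    (mH : ∀ v : HeightOneSpectrum (𝓞 ↥(maximalRealSubfield L)),
      OrbitalMeasureFamily ((cmDatum L 2 (Matrix.of fun i j : Fin 2 => if i.val + j.val + 1 = 2 then (1 : L) else 0)).Local v ×
        (cmDatum L 1 (Matrix.of fun i j : Fin 1 => if i.val + j.val + 1 = 1 then (1 : L) else 0)).Local v))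
    (mG : ∀ v : HeightOneSpectrum (𝓞 ↥(maximalRealSubfield L)), OrbitalMeasureFamily ((cmDatum L 3 H).Local v))
    (νH : ∀ v : HeightOneSpectrum (𝓞 ↥(maximalRealSubfield L)),
      Measure ((cmDatum L 2 (Matrix.of fun i j : Fin 2 => if i.val + j.val + 1 = 2 then (1 : L) else 0)).Local v ×
        (cmDatum L 1 (Matrix.of fun i j : Fin 1 => if i.val + j.val + 1 = 1 then (1 : L) else 0)).Local v))
    (νG : ∀ v : HeightOneSpectrum (𝓞 ↥(maximalRealSubfield L)), Measure ((cmDatum L 3 H).Local v))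
    (ξ : OneDimAutRepH L) (μω : HeckeCharacter L)
    (ξloc : ∀ v : HeightOneSpectrum (𝓞 ↥(maximalRealSubfield L)),
      (cmDatum L 2 (Matrix.of fun i j : Fin 2 => if i.val + j.val + 1 = 2 then (1 : L) else 0)).Local v ×
        (cmDatum L 1 (Matrix.of fun i j : Fin 1 => if i.val + j.val + 1 = 1 then (1 : L) else 0)).Local v →* ℂˣ)
    {n' : ℕ} (e₁ : Fin 3 × Fin 1 ≃ Fin n') (dV : Fin 3 → L) (hdV : ∀ i, IsCMField.complexConj L (dV i) = dV i) (hdV0 : ∀ i, dV i ≠ 0) (g : GL (Fin 3) L)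
    (hg : ((g : Matrix (Fin 3) (Fin 3) L).map (cmConjRingHom L))ᵀ * H * (g : Matrix (Fin 3) (Fin 3) L) = Matrix.diagonal dV) : Prop :=
    ∀ (μ : Literature.NumberTheory.Automorphic.IdeleClassGroup L →ₜ* Circle) (hμ : IsConjugateSymplectic L μ)
    (χf : UnitaryGroup.finAdelicOne (↥(maximalRealSubfield L)) L (IsCMField.complexConj L) →* ℂˣ),
    Continuous χf → (∀ z, ‖((χf z : ℂˣ) : ℂ)‖ = 1) →
    (∀ v : HeightOneSpectrum (𝓞 ↥(maximalRealSubfield L)),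
        (toHeckeCharacter L μ).semilocalComponent L v = (ξ.bcη⁻¹ * ξ.bcψ⁻¹ * μω).semilocalComponent L v) →
    (∀ z : (FiniteAdeleRing (𝓞 L) L)ˣ,
        χf (finAdelicCheck (↥(maximalRealSubfield L)) L (IsCMField.complexConj L)
            (AlgEquiv.ext fun x => by rw [AlgEquiv.mul_apply, IsCMField.complexConj_apply_apply, AlgEquiv.one_apply]) z) =
          (ξ.bcψ⁻¹ * (ξ.bcη⁻¹ * ξ.bcψ⁻¹ * μω) ^ 2)
            (Units.map (N := AdeleRing (𝓞 L) L) (MonoidHom.inr (InfiniteAdeleRing L) (FiniteAdeleRing (𝓞 L) L)) z)) →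
    ∀ (v : HeightOneSpectrum (𝓞 ↥(maximalRealSubfield L))),
      (∀ w : PlacesOver L v, IsCMField.complexConj L • w.1 = w.1) →
      ∀ (T : GL (Fin 3) (LocalRing L v)) (a : LocalRing L v) (ha : IsUnit a)
        (h : formCongr (conjLocal L (IsCMField.complexConj L) v) T (H.map (algebraMap L (LocalRing L v))) =
          a • (Matrix.of fun i j : Fin 3 => if i.val + j.val + 1 = 3 then (1 : L) else 0).map (algebraMap L (LocalRing L v))),
      ∀ [MeasurableSpace (Gqs L v ⧸ Subgroup.center (Gqs L v))] [BorelSpace (Gqs L v ⧸ Subgroup.center (Gqs L v))]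
        (μZ : Measure (Gqs L v ⧸ Subgroup.center (Gqs L v))) [μZ.IsHaarMeasure],
      ∀ (π2 πn : IrrClass (Gqs L v)),
        KeysCaseTwoLabels L v (μω.semilocalComponent L v) (torusLocalComponent L (IsCMField.complexConj L) v ξ.η)
          (torusLocalComponent L (IsCMField.complexConj L) v ξ.ψ) π2 πn →
        ¬ πn.IsSquareIntegrable μZ →
        ∃ (ε : (↥(maximalRealSubfield L))ˣ) (πθ : IrrClass ((cmDatum L 3 H).Local v)),
          (⟨IrrClass.comap (cmDatumLocalCongr L v T ha h).symm πn, some πθ⟩ : CMLocalAPacket L H v).CharIdentityAt L H v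
              (fun c f => c.smoothTrace (νG v) f) (ξloc v) (νH v) (Δ v) (mH v) (mG v) ∧
            ThetaTypeAtCM L H e₁ dV hdV hdV0 g hg μ hμ χf ε v πθ

/-- unfolding of `piSCompletion_isThetaTypeAtCM` (definitional). [cite: GelbartRogawski1991, Lem. 5.1.2 p. 466] -/
theorem piSCompletion_isThetaTypeAtCM_iff
    [∀ v : HeightOneSpectrum (𝓞 ↥(maximalRealSubfield L)), MeasurableSpace ((cmDatum L 3 H).Local v)]
    [∀ v : HeightOneSpectrum (𝓞 ↥(maximalRealSubfield L)),
      MeasurableSpace ((cmDatum L 2 (Matrix.of fun i j : Fin 2 => if i.val + j.val + 1 = 2 then (1 : L) else 0)).Local v ×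
        (cmDatum L 1 (Matrix.of fun i j : Fin 1 => if i.val + j.val + 1 = 1 then (1 : L) else 0)).Local v)]
    [∀ (v : HeightOneSpectrum (𝓞 ↥(maximalRealSubfield L)))
        (a : ((cmDatum L 2 (Matrix.of fun i j : Fin 2 => if i.val + j.val + 1 = 2 then (1 : L) else 0)).Local v ×
          (cmDatum L 1 (Matrix.of fun i j : Fin 1 => if i.val + j.val + 1 = 1 then (1 : L) else 0)).Local v)),
      MeasurableSpace (((cmDatum L 2 (Matrix.of fun i j : Fin 2 => if i.val + j.val + 1 = 2 then (1 : L) else 0)).Local v ×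
          (cmDatum L 1 (Matrix.of fun i j : Fin 1 => if i.val + j.val + 1 = 1 then (1 : L) else 0)).Local v) ⧸
        Subgroup.centralizer ({a} : Set ((cmDatum L 2 (Matrix.of fun i j : Fin 2 => if i.val + j.val + 1 = 2 then (1 : L) else 0)).Local v ×
          (cmDatum L 1 (Matrix.of fun i j : Fin 1 => if i.val + j.val + 1 = 1 then (1 : L) else 0)).Local v)))]
    [∀ (v : HeightOneSpectrum (𝓞 ↥(maximalRealSubfield L))) (γ : (cmDatum L 3 H).Local v),
      MeasurableSpace ((cmDatum L 3 H).Local v ⧸ Subgroup.centralizer ({γ} : Set ((cmDatum L 3 H).Local v)))]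
    (Δ : ∀ v : HeightOneSpectrum (𝓞 ↥(maximalRealSubfield L)), LocalTransferFactor L H v)
    (mH : ∀ v : HeightOneSpectrum (𝓞 ↥(maximalRealSubfield L)),
      OrbitalMeasureFamily ((cmDatum L 2 (Matrix.of fun i j : Fin 2 => if i.val + j.val + 1 = 2 then (1 : L) else 0)).Local v ×
        (cmDatum L 1 (Matrix.of fun i j : Fin 1 => if i.val + j.val + 1 = 1 then (1 : L) else 0)).Local v))
    (mG : ∀ v : HeightOneSpectrum (𝓞 ↥(maximalRealSubfield L)), OrbitalMeasureFamily ((cmDatum L 3 H).Local v))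
    (νH : ∀ v : HeightOneSpectrum (𝓞 ↥(maximalRealSubfield L)),
      Measure ((cmDatum L 2 (Matrix.of fun i j : Fin 2 => if i.val + j.val + 1 = 2 then (1 : L) else 0)).Local v ×
        (cmDatum L 1 (Matrix.of fun i j : Fin 1 => if i.val + j.val + 1 = 1 then (1 : L) else 0)).Local v))
    (νG : ∀ v : HeightOneSpectrum (𝓞 ↥(maximalRealSubfield L)), Measure ((cmDatum L 3 H).Local v))
    (ξ : OneDimAutRepH L) (μω : HeckeCharacter L)
    (ξloc : ∀ v : HeightOneSpectrum (𝓞 ↥(maximalRealSubfield L)),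
      (cmDatum L 2 (Matrix.of fun i j : Fin 2 => if i.val + j.val + 1 = 2 then (1 : L) else 0)).Local v ×
        (cmDatum L 1 (Matrix.of fun i j : Fin 1 => if i.val + j.val + 1 = 1 then (1 : L) else 0)).Local v →* ℂˣ)
    {n' : ℕ} (e₁ : Fin 3 × Fin 1 ≃ Fin n') (dV : Fin 3 → L) (hdV : ∀ i, IsCMField.complexConj L (dV i) = dV i) (hdV0 : ∀ i, dV i ≠ 0) (g : GL (Fin 3) L)
    (hg : ((g : Matrix (Fin 3) (Fin 3) L).map (cmConjRingHom L))ᵀ * H * (g : Matrix (Fin 3) (Fin 3) L) = Matrix.diagonal dV) :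
    piSCompletion_isThetaTypeAtCM L H Δ mH mG νH νG ξ μω ξloc e₁ dV hdV hdV0 g hg ↔
    (  ∀ (μ : Literature.NumberTheory.Automorphic.IdeleClassGroup L →ₜ* Circle) (hμ : IsConjugateSymplectic L μ)
        (χf : UnitaryGroup.finAdelicOne (↥(maximalRealSubfield L)) L (IsCMField.complexConj L) →* ℂˣ),
        Continuous χf → (∀ z, ‖((χf z : ℂˣ) : ℂ)‖ = 1) →
        (∀ v : HeightOneSpectrum (𝓞 ↥(maximalRealSubfield L)),
            (toHeckeCharacter L μ).semilocalComponent L v = (ξ.bcη⁻¹ * ξ.bcψ⁻¹ * μω).semilocalComponent L v) →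
        (∀ z : (FiniteAdeleRing (𝓞 L) L)ˣ,
            χf (finAdelicCheck (↥(maximalRealSubfield L)) L (IsCMField.complexConj L)
                (AlgEquiv.ext fun x => by rw [AlgEquiv.mul_apply, IsCMField.complexConj_apply_apply, AlgEquiv.one_apply]) z) =
              (ξ.bcψ⁻¹ * (ξ.bcη⁻¹ * ξ.bcψ⁻¹ * μω) ^ 2)
                (Units.map (N := AdeleRing (𝓞 L) L) (MonoidHom.inr (InfiniteAdeleRing L) (FiniteAdeleRing (𝓞 L) L)) z)) →
        ∀ (v : HeightOneSpectrum (𝓞 ↥(maximalRealSubfield L))),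
          (∀ w : PlacesOver L v, IsCMField.complexConj L • w.1 = w.1) →
          ∀ (T : GL (Fin 3) (LocalRing L v)) (a : LocalRing L v) (ha : IsUnit a)
            (h : formCongr (conjLocal L (IsCMField.complexConj L) v) T (H.map (algebraMap L (LocalRing L v))) =
              a • (Matrix.of fun i j : Fin 3 => if i.val + j.val + 1 = 3 then (1 : L) else 0).map (algebraMap L (LocalRing L v))),
          ∀ [MeasurableSpace (Gqs L v ⧸ Subgroup.center (Gqs L v))] [BorelSpace (Gqs L v ⧸ Subgroup.center (Gqs L v))]
            (μZ : Measure (Gqs L v ⧸ Subgroup.center (Gqs L v))) [μZ.IsHaarMeasure],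
          ∀ (π2 πn : IrrClass (Gqs L v)),
            KeysCaseTwoLabels L v (μω.semilocalComponent L v) (torusLocalComponent L (IsCMField.complexConj L) v ξ.η)
              (torusLocalComponent L (IsCMField.complexConj L) v ξ.ψ) π2 πn →
            ¬ πn.IsSquareIntegrable μZ →
            ∃ (ε : (↥(maximalRealSubfield L))ˣ) (πθ : IrrClass ((cmDatum L 3 H).Local v)),
              (⟨IrrClass.comap (cmDatumLocalCongr L v T ha h).symm πn, some πθ⟩ : CMLocalAPacket L H v).CharIdentityAt L H v
                  (fun c f => c.smoothTrace (νG v) f) (ξloc v) (νH v) (Δ v) (mH v) (mG v) ∧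
                ThetaTypeAtCM L H e₁ dV hdV hdV0 g hg μ hμ χf ε v πθ) :=
  Iff.rfl

end Literature.NumberTheory.GelbartRogawski1991

end
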